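import Summits.NavierStokesRegularity.FluidComputer.ClayBlowupSerrin
import HarnessLib

/-!
# Two readings of the Clay blow-up: the localized bridge to `DesignedBlowup`, and the forced
# Ladyzhenskaya–Prodi–Serrin criterion for Clay data

Cell `ns-blowup`, seat `ns-blowup-ecbridge-2` (g5; the E–C endpoint theory seat). LABEL: E–C typing
(KERNEL — no named fact). WHAT THIS IS NOT: not Navier–Stokes evidence — statements about TYPES
nobody has inhabited and a conditional regularity criterion; nothing is constructed.
Companion memo: `run/shared/lean/pub/ns-blowup/ecbridge2/ECBRIDGE-2-MEMO-4.md` §3–§4.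

## Content

* `setLIntegral_Ioo_le_of_forall_lt` — exhaustion: a bound on `∫_{(0,τ)} g` for every `τ < T` bounds
  `∫_{(0,T)} g` (monotone convergence along `τ ↑ T`).
* `ClayBlowup.unboundedOn_of_bounded_outside`, **`ClayBlowup.toDesignedBlowupOfBoundedOutside`** —
  THE GAP BETWEEN THE TWO TYPES, LOCALIZED: a Clay blow-up whose velocity stays bounded OUTSIDE a
  compact set `K` on some `(t₀, T)` is unbounded on `[0, T) × K`, hence admits no classical
  extension at all and IS a `DesignedBlowup` (`DesignedBlowup.ofEnergyUnboundedOn`). What is missing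
  for `ClayBlowup → DesignedBlowup` in general is exactly the exclusion of a singularity escaping to
  spatial infinity.
* **`ClayEvolution.exists_claySolution_of_serrinBound`** — THE FORCED LADYZHENSKAYA–PRODI–SERRIN
  CRITERION FOR CLAY DATA (kernel, no named fact): `ν > 0`, Clay datum `u₀`, Clay force `f`,
  `3 < r ≤ ∞`; if every finite-energy classical piece `(v, q)` on `[0, τ]` of the evolution obeys
  `∫₀^τ ‖v(t)‖_{L^r}^{2/(1−3/r)} dt ≤ A` with ONE `A < ∞`, then `(u₀, f)` has a global Clay-class
  solution (the dichotomy: a Clay blow-up with these data would have a finite Serrin integral,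
  against `ClayBlowup.lintegral_serrin_eq_top`).

References: H. Sohr (2001), Thm. V.1.8.1 [cite: Sohr2001, Thm. V.1.8.1]; P. G. Lemarié-Rieusset
(2016), Thm. 11.2 [cite: LemarieRieusset2016, Thm. 11.2]; C. L. Fefferman, Clay problem description,
(A), (C) [cite: FeffermanClay2006, (A) (C)]; J. T. Beale, T. Kato, A. Majda, Comm. Math. Phys. 94
(1984) §1 [cite: BealeKatoMajda1984, §1].
-/

noncomputable section

namespace Summit.NavierStokesRegularity.FluidComputer

open Set MeasureTheory Filter Topology Function
open scoped ENNReal ContDiff NNReal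
open Literature.Analysis.FluidPDE
open Summit.NavierStokesRegularity.NavierStokesRegularity

/-! ## §1 Exhaustion of `(0, T)` by `(0, τ)`, `τ ↑ T` -/

/-- **A uniform bound on `∫_{(0,τ)} g`, `τ < T`, bounds `∫_{(0,T)} g`** (monotone convergence
along the slabs `(0, T − T/(n+2))`). [folklore] -/
theorem setLIntegral_Ioo_le_of_forall_lt {T : ℝ} (hT : 0 < T) {g : ℝ → ℝ≥0∞} {A : ℝ≥0∞}
    (h : ∀ τ ∈ Ioo 0 T, ∫⁻ t in Ioo 0 τ, g t ≤ A) : ∫⁻ t in Ioo 0 T, g t ≤ A := by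
  set Tn : ℕ → ℝ := fun n => T - T / (n + 2) with hTn
  have hTn_pos : ∀ n, 0 < Tn n := fun n => by
    have h2 : (2 : ℝ) ≤ (n : ℝ) + 2 := by
      have := (Nat.cast_nonneg n : (0 : ℝ) ≤ (n : ℝ)); linarith
    have : T / (n + 2) ≤ T / 2 := div_le_div_of_nonneg_left hT.le (by norm_num) h2
    simp only [hTn]; linarith
  have hTn_lt : ∀ n, Tn n < T := fun n => by
    simp only [hTn]
    have : 0 < T / (n + 2) := div_pos hT (by positivity)
    linarith
  have hTn_mono : Monotone Tn := fun m n hmn => by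
    simp only [hTn]
    have : T / (n + 2) ≤ T / (m + 2) :=
      div_le_div_of_nonneg_left hT.le (by positivity) (by exact_mod_cast Nat.add_le_add_right hmn 2)
    linarith
  have hmonoI : Monotone fun n => Ioo (0 : ℝ) (Tn n) := fun m n hmn =>
    Ioo_subset_Ioo_right (hTn_mono hmn)
  have hdir : Directed (· ⊆ ·) fun n => Ioo (0 : ℝ) (Tn n) := hmonoI.directed_le
  have hU : (⋃ n, Ioo (0 : ℝ) (Tn n)) = Ioo 0 T := by
    refine Subset.antisymm (iUnion_subset fun n => Ioo_subset_Ioo_right (hTn_lt n).le) fun t ht => ?_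
    obtain ⟨n, hn⟩ := exists_nat_gt (T / (T - t))
    have hTt : 0 < T - t := sub_pos.2 ht.2
    refine mem_iUnion.2 ⟨n, ht.1, ?_⟩
    simp only [hTn]
    have hn2 : T / (T - t) < (n : ℝ) + 2 := by linarith
    have : T / ((n : ℝ) + 2) < T - t := by
      rw [div_lt_iff₀ (by positivity)]
      have h1 : T = T / (T - t) * (T - t) := by field_simp
      have h2 : T / (T - t) * (T - t) < ((n : ℝ) + 2) * (T - t) :=
        mul_lt_mul_of_pos_right hn2 hTt
      linarith [mul_comm ((n : ℝ) + 2) (T - t)]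
    linarith
  rw [← hU, setLIntegral_iUnion_of_directed _ hdir]
  exact iSup_le fun n => h (Tn n) ⟨hTn_pos n, hTn_lt n⟩

namespace ClayBlowup

variable {ν : ℝ} (X : ClayBlowup ν)

/-! ## §2 The localized bridge to `DesignedBlowup` -/

/-- **A Clay blow-up bounded outside a compact set near `T` is unbounded ON that set**: if
`‖u(t, x)‖ ≤ M` for `t ∈ [t₀, T)`, `x ∉ K` (with `t₀ < T`), then for every `M'` some `(t, x)`,
`t < T`, `x ∈ K`, has `‖u(t, x)‖ > M'` (the blow-up is unbounded on `[0, T) × ℝ³`,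
`velocity_unbounded`, bounded on `[0, t₀]`, `exists_norm_le`, and bounded off `K` after `t₀`).
`ν > 0`; no named fact. [cite: LemarieRieusset2016, Thm. 11.2] -/
theorem unboundedOn_of_bounded_outside (hν : 0 < ν) {K : Set (EuclideanSpace ℝ (Fin 3))}
    {t₀ M : ℝ} (ht₀ : t₀ < X.T) (hout : ∀ t ∈ Ico t₀ X.T, ∀ x, x ∉ K → ‖X.u t x‖ ≤ M) :
    ∀ M' : ℝ, ∃ t ∈ Ico 0 X.T, ∃ x ∈ K, M' < ‖X.u t x‖ := by
  intro M'
  obtain ⟨B, hB⟩ := X.exists_norm_le hν ht₀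
  obtain ⟨t, ht, x, hx⟩ := X.exists_norm_gt hν (max M' (max M B))
  have hM' : M' < ‖X.u t x‖ := (le_max_left _ _).trans_lt hx
  have hM : M < ‖X.u t x‖ := ((le_max_left _ _).trans (le_max_right _ _)).trans_lt hx
  have hB' : B < ‖X.u t x‖ := ((le_max_right _ _).trans (le_max_right _ _)).trans_lt hx
  have htt₀ : t₀ ≤ t := by
    by_contra hlt
    exact absurd hB' (not_lt.2 (hB t ⟨ht.1, (not_le.1 hlt).le⟩ x))
  refine ⟨t, ht, x, ?_, hM'⟩
  by_contra hxK
  exact absurd hM (not_lt.2 (hout t ⟨htt₀, ht.2⟩ x hxK))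

/-- **THE TWO TYPES COINCIDE FOR SPATIALLY LOCALIZED BLOW-UPS**: a Clay blow-up (`ν > 0`) whose
velocity is bounded outside a compact set `K` on some `[t₀, T)` is unbounded on `[0, T) × K`, hence
admits NO classical extension past `T` whatsoever (continuity on the compact box), i.e. it is a
designed blow-up (`DesignedBlowup.ofEnergyUnboundedOn`). The general implication
`ClayBlowup → DesignedBlowup` lacks exactly the exclusion of a singularity escaping to spatial
infinity. [cite: BealeKatoMajda1984, §1] [cite: FeffermanClay2006, (C)] -/
def toDesignedBlowupOfBoundedOutside (hν : 0 < ν) {K : Set (EuclideanSpace ℝ (Fin 3))}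
    (hK : IsCompact K) {t₀ M : ℝ} (ht₀ : t₀ < X.T)
    (hout : ∀ t ∈ Ico t₀ X.T, ∀ x, x ∉ K → ‖X.u t x‖ ≤ M) : DesignedBlowup ν :=
  DesignedBlowup.ofEnergyUnboundedOn hν X.T X.T_pos X.u X.p X.f X.classical K hK
    (X.unboundedOn_of_bounded_outside hν ht₀ hout) X.datum_decay X.force_smooth X.force_decay X.energy

/-- The designed blow-up of `toDesignedBlowupOfBoundedOutside` has the same velocity. [folklore] -/
theorem toDesignedBlowupOfBoundedOutside_u (hν : 0 < ν) {K : Set (EuclideanSpace ℝ (Fin 3))}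
    (hK : IsCompact K) {t₀ M : ℝ} (ht₀ : t₀ < X.T)
    (hout : ∀ t ∈ Ico t₀ X.T, ∀ x, x ∉ K → ‖X.u t x‖ ≤ M) :
    (X.toDesignedBlowupOfBoundedOutside hν hK ht₀ hout).u = X.u :=
  rfl

/-- Under the localization hypothesis the Clay blow-up admits no classical extension at all.
[cite: BealeKatoMajda1984, §1] -/
theorem not_hasSmoothExtensionPast_of_bounded_outside (hν : 0 < ν)
    {K : Set (EuclideanSpace ℝ (Fin 3))} (hK : IsCompact K) {t₀ M : ℝ} (ht₀ : t₀ < X.T)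
    (hout : ∀ t ∈ Ico t₀ X.T, ∀ x, x ∉ K → ‖X.u t x‖ ≤ M) :
    ¬ HasSmoothExtensionPast ν X.f X.u X.T :=
  (X.toDesignedBlowupOfBoundedOutside hν hK ht₀ hout).no_extension

end ClayBlowup

/-! ## §3 The forced Ladyzhenskaya–Prodi–Serrin criterion for Clay data -/

namespace ClayEvolution

variable {ν : ℝ} {f : ℝ → EuclideanSpace ℝ (Fin 3) → EuclideanSpace ℝ (Fin 3)}
  {u₀ : EuclideanSpace ℝ (Fin 3) → EuclideanSpace ℝ (Fin 3)}

/-- **FORCED LADYZHENSKAYA–PRODI–SERRIN FOR CLAY DATA** (kernel, no named fact). Let `ν > 0`,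
`u₀` a Clay datum, `f` a Clay force, `3 < r ≤ ∞`, and suppose ONE `A < ∞` bounds the Serrin integral
`∫₀^τ ‖v(t)‖_{L^r}^{2/(1−3/r)} dt` of EVERY finite-energy classical piece `(v, q)` of the evolution on
`[0, τ]`. Then `(u₀, f)` has a global Clay-class solution: smooth on `[0, ∞) × ℝ³`, Fefferman
(1)–(3), (6), bounded energy (7). (Dichotomy `exists_claySolution_or_clayBlowup`; a Clay blow-up with
these data restricts to pieces, so its Serrin integral over `(0, T)` is `≤ A` by exhaustion,
contradicting the Sohr corner `ClayBlowup.lintegral_serrin_eq_top`.) [cite: Sohr2001, Thm. V.1.8.1]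
[cite: LemarieRieusset2016, Thm. 11.2] -/
theorem exists_claySolution_of_serrinBound (hν : 0 < ν) (hu₀ : ContDiff ℝ ∞ u₀)
    (hdiv : NSWave0.IsDivFree u₀) (hdec : HasRapidSpatialDecay u₀) (hs : IsSmoothOnHalfSpace f)
    (hd : HasRapidSpaceTimeDecay f) {r : ℝ≥0∞} (hr : 3 < r) {A : ℝ≥0∞} (hA : A < ⊤)
    (hbound : ∀ P : Piece ν f u₀, ∫⁻ t in Ioo 0 P.τ,
      ENNReal.ofReal ((eLpNorm (P.v t) r volume).toReal ^ (2 / (1 - (3 / r).toReal))) ≤ A) :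
    ∃ (u : ℝ → EuclideanSpace ℝ (Fin 3) → EuclideanSpace ℝ (Fin 3))
      (p : ℝ → EuclideanSpace ℝ (Fin 3) → ℝ),
      IsSmoothOnHalfSpace u ∧ IsSmoothOnHalfSpace p ∧
        IsNavierStokesSolution ν f u₀ u p ∧ HasBoundedEnergy u := by
  rcases exists_claySolution_or_clayBlowup hν hu₀ hdiv hdec hs hd with hsol | ⟨X, hX0, hXf⟩
  · exact hsol
  · exfalso
    have htop := X.lintegral_serrin_eq_top hν hr
    have hle : ∫⁻ t in Ioo 0 X.T,
        ENNReal.ofReal ((eLpNorm (X.u t) r volume).toReal ^ (2 / (1 - (3 / r).toReal))) ≤ A := by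
      refine setLIntegral_Ioo_le_of_forall_lt X.T_pos fun τ hτ => ?_
      have hcl : IsClassicalNSSolutionOn (Ico 0 X.T) ν f X.u X.p := by rw [← hXf]; exact X.classical
      exact hbound (Piece.ofIco hcl hX0 X.energy hτ.1 hτ.2)
    exact absurd (htop ▸ hle) (not_le.2 hA)

end ClayEvolution

end Summit.NavierStokesRegularity.FluidComputer

end
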